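import Literature.Computability.Complexity.KarpProblems
import Literature.Computability.Complexity.IndexAllBricks
import Literature.Computability.Complexity.PlumbingBricks
import Literature.Computability.Complexity.FPStringBricks
import Literature.Computability.Complexity.ListFoldChecks
import Literature.Computability.Complexity.NPClosureProofs
import Literature.Computability.Complexity.StringCopy
import HarnessLib

/-!
# `CLIQUE ∈ NP`: the graph-code test and the clique verifier in `P` (Karp 1972, Main Theorem, problem 3)

Membership half of the discharge of `Literature.Computability.Complexity.isNPComplete_CLIQUE`
(`KarpProblems.lean`; R. M. Karp, *Reducibility among combinatorial problems*, 1972, §4, Main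
Theorem, problem 3: "CLIQUE. INPUT: graph `G`, positive integer `k`. PROPERTY: `G` has a set of `k`
mutually adjacent nodes."). Karp: "It is clear that these problems (or, more precisely, their
encodings into `Σ*`), are all in NP" (§4, after the list), NP being "the set of languages derived
from elements of `P⁽²⁾` by polynomial-bounded existential quantification" (§3, Def. 4) — literally
the tree's `NP = polyExists P` (`Nondeterministic.lean`). This file proves it for the tree's
language `CLIQUE = (encodingGraph.pairBool encodingNatBool).toLanguage cliqueSet` at the machine
level (Mathlib's `TM2` through the tree's algebra of `FP` string functions; no machine is written),
following the pattern of `Literature/Barriers/HubbardSuperconductivity/SignProblemNPHardIsingNP.lean`: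

* **The instance coding, field by field** (`instEnc_encode_eq`): the code of `(⟨n, G⟩, k)` is
  `⟨⟨encodeNat n, adjBits n G⟩, encodeNat k⟩`, `adjBits` the row-major adjacency bits (`n²` of them).
* **The graph-code test** `codeT ∈ FP` (one bit): a string `x` is the code of SOME instance iff it
  is well paired twice, both numerals are canonical (`Brick.canonF` fixes them), the bit field has
  `n²` symbols, and the bit matrix is symmetric with zero diagonal (`Brick.allIdxFn` over the flat
  index `t = i n + j`, `Plumb.divModFn`, `bitAtFn`); `codeT_eq_true_iff`. A language defined as an
  IMAGE `encode '' S` needs this test: the verifier must reject non-codewords (the decoder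
  `SimpleGraph.fromRel` of `encodingGraphFin` identifies many bit matrices with one graph, but only
  the symmetric loop-free matrix is a code word).
* **The clique verifier** `verifT ∈ FP` on `⟨x, y⟩`: the witness `y` must be the characteristic
  vector of a vertex set `S` (`|y| = n`), with `k ≤ |S|` (`popCountFn`, `Brick.ltFn`) and `S`
  pairwise adjacent (`Brick.allIdxFn` over `t = i n + j`: `y[i] ∧ y[j] ∧ i ≠ j → bit t`); its exact
  value on the code of ANY instance paired with ANY string is `verifT_encode`.
* **Assembly** `CLIQUE_mem_NP`: `CLIQUE = codeLang ⊓ witnessLang` (a `k`-clique `s` gives the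
  witness `List.ofFn (· ∈ s)`; an accepted witness gives a clique with at least `k` vertices, hence a
  `k`-clique inside it), an intersection of a `P` language with a language in certificate form
  (`inter_P_mem_polyExists`).

## Design notes

* The witness is required to have length exactly `n` (`lenT`), so that it IS the characteristic
  vector of the chosen vertex set and the count test is a plain `popCountFn`; Karp's "set of `k`
  mutually adjacent nodes" is recovered from "at least `k` pairwise adjacent chosen vertices" by
  `Finset.exists_subset_card_eq`. The tree's `cliqueSet` allows `k = 0` (always a member); nothing
  special happens there.
* The small plumbing lemmas `wpF`/`wpF_apply`, `andFn_decide`, `mem_P_of_oneBit`, `hdrT`,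
  `headD_drop`, `flat_div`/`flat_mod`, `ones_inj` are twins of lemmas of
  `SignProblemNPHardIsingNP.lean` (a barrier file), `CircuitEvalPrograms.lean`, `APSPWordRAM.lean`,
  `ADHMachine.lean`, restated here (a few lines each) rather than importing those developments into
  the complexity trunk.

## References

* R. M. Karp, *Reducibility among combinatorial problems*, in: R. E. Miller, J. W. Thatcher (eds.),
  Complexity of Computer Computations, Plenum 1972, 85–103: §3 Def. 4 (NP), §4 Def. 5, Main
  Theorem (problem 3, CLIQUE) and the remark "these problems … are all in NP".
* S. Arora, B. Barak, *Computational Complexity: A Modern Approach*, CUP 2009, Def. 2.1 (`NP` by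
  certificates), §0.1 (codes), §1.3 (closure of polynomial time under composition and bounded loops).
-/

noncomputable section

namespace Literature.Computability.Complexity

open _root_.Computability Brick OracleCompose Plumb HashBricks Polynomial Finset

namespace CliqueNP

/-! ### The instance coding, field by field -/

/-- The coding of `CLIQUE` instances `(⟨n, G⟩, k)`. [cite: Karp1972, §4 Main Theorem, problem 3] -/
abbrev instEnc : Encoding ((Σ n, SimpleGraph (Fin n)) × ℕ) Bool :=
  encodingGraph.pairBool encodingNatBool

/-- `CLIQUE` is the image of `cliqueSet` under `instEnc`. [folklore] -/
theorem CLIQUE_eq_image : CLIQUE = instEnc.encode '' cliqueSet := rfl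

open Classical in
/-- The row-major adjacency bits of a graph on `Fin n`: bit `t = i n + j` is `[G.Adj i j]`.
[cite: AroraBarak2009, §0.1 (adjacency-matrix representation)] -/
def adjBits (n : ℕ) (G : SimpleGraph (Fin n)) : List Bool :=
  List.ofFn fun t : Fin (n * n) => decide (G.Adj t.divNat t.modNat)

/-- There are `n²` adjacency bits. [folklore] -/
@[simp] theorem length_adjBits (n : ℕ) (G : SimpleGraph (Fin n)) : (adjBits n G).length = n * n := by
  simp [adjBits]

/-- Row and column of a flat index below `n²`. [folklore] -/
theorem div_lt_of_lt_mul {n t : ℕ} (ht : t < n * n) : t / n < n :=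
  Nat.div_lt_of_lt_mul (by rwa [Nat.mul_comm])

/-- `n` is positive if some flat index is below `n²`. [folklore] -/
theorem pos_of_lt_mul {n t : ℕ} (ht : t < n * n) : 0 < n :=
  Nat.pos_of_ne_zero fun h => by simp [h] at ht

/-- The flat index of `(i, j)` is below `n²`. [folklore] -/
theorem flat_lt {n : ℕ} (i j : Fin n) : (i : ℕ) * n + j < n * n := by
  have h1 : ((i : ℕ) + 1) * n ≤ n * n := Nat.mul_le_mul_right n (Nat.succ_le_of_lt i.isLt)
  rw [Nat.succ_mul] at h1
  have := j.isLt
  omega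

/-- Row of the flat index of `(i, j)`. [folklore] -/
theorem flat_div {n : ℕ} (i j : Fin n) : ((i : ℕ) * n + j) / n = i := by
  rw [Nat.add_comm, Nat.add_mul_div_right _ _ (Fin.pos i), Nat.div_eq_of_lt j.isLt, Nat.zero_add]

/-- Column of the flat index of `(i, j)`. [folklore] -/
theorem flat_mod {n : ℕ} (i j : Fin n) : ((i : ℕ) * n + j) % n = j := by
  rw [Nat.add_comm, Nat.add_mul_mod_self_right, Nat.mod_eq_of_lt j.isLt]

open Classical in
/-- Bit `t < n²` of `adjBits n G` is `[G.Adj (t / n) (t % n)]`. [folklore] -/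
theorem getD_adjBits {n : ℕ} (G : SimpleGraph (Fin n)) {t : ℕ} (ht : t < n * n) :
    (adjBits n G).getD t false =
      decide (G.Adj ⟨t / n, div_lt_of_lt_mul ht⟩ ⟨t % n, Nat.mod_lt _ (pos_of_lt_mul ht)⟩) := by
  rw [List.getD_eq_getElem _ _ (by simpa using ht)]
  simp [adjBits, Fin.divNat, Fin.modNat]

open Classical in
/-- Bit `i n + j` of `adjBits n G` is `[G.Adj i j]`. [folklore] -/
theorem getD_adjBits_flat {n : ℕ} (G : SimpleGraph (Fin n)) (i j : Fin n) :
    (adjBits n G).getD (i * n + j) false = decide (G.Adj i j) := by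
  rw [getD_adjBits G (flat_lt i j)]
  have hi : (⟨((i : ℕ) * n + j) / n, div_lt_of_lt_mul (flat_lt i j)⟩ : Fin n) = i := Fin.ext (flat_div i j)
  have hj : (⟨((i : ℕ) * n + j) % n, Nat.mod_lt _ (pos_of_lt_mul (flat_lt i j))⟩ : Fin n) = j :=
    Fin.ext (flat_mod i j)
  rw [hi, hj]

/-- The code of a graph is its adjacency bit list. [folklore] -/
theorem encodingGraphFin_encode_eq (n : ℕ) (G : SimpleGraph (Fin n)) :
    (encodingGraphFin n).encode G = adjBits n G := by
  classical
  unfold adjBits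
  simp only [encodingGraphFin, encodingBitVec]
  rfl

/-- **The code of an instance, field by field**: `⟨⟨encodeNat n, adjBits n G⟩, encodeNat k⟩`.
[cite: AroraBarak2009, §0.1] -/
theorem instEnc_encode_eq (n : ℕ) (G : SimpleGraph (Fin n)) (k : ℕ) :
    instEnc.encode (⟨n, G⟩, k) = boolPair (boolPair (encodeNat n) (adjBits n G)) (encodeNat k) := by
  change boolPair (encodingGraph.encode ⟨n, G⟩) (encodeNat k) = _
  rw [encodingGraph_encode, encodingGraphFin_encode_eq]

/-- `n² ≤ |code (⟨n, G⟩, k)|` (the bit field alone has `n²` symbols). [folklore] -/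
theorem nsq_le_length_encode (n : ℕ) (G : SimpleGraph (Fin n)) (k : ℕ) :
    n * n ≤ (instEnc.encode (⟨n, G⟩, k)).length := by
  rw [instEnc_encode_eq]
  simp only [length_boolPair, length_adjBits]
  omega

/-- `n ≤ |code (⟨n, G⟩, k)|`. [folklore] -/
theorem n_le_length_encode (n : ℕ) (G : SimpleGraph (Fin n)) (k : ℕ) :
    n ≤ (instEnc.encode (⟨n, G⟩, k)).length := by
  have h := nsq_le_length_encode n G k
  rcases Nat.eq_zero_or_pos n with h0 | hpos
  · omega
  · nlinarith

/-! ### One-bit tests: pairing, canonical numerals, the bit-field header -/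

/-- Conjunction of decided propositions. [folklore] -/
theorem andFn_decide {c d : List Bool → List Bool} {z : List Bool} {P Q : Prop} [Decidable P] [Decidable Q]
    (h : c z = [decide P]) (h' : d z = [decide Q]) : andFn c d z = [decide (P ∧ Q)] := by
  rw [andFn_apply h h', Bool.decide_and]

/-- **Well-pairedness test** `wpF u = [⟨fst u, snd u⟩ = u]` (`u` is in the range of `boolPair`).
[cite: AroraBarak2009, §0.1] -/
def wpF : List Bool → List Bool := eqPairFn ∘ fanoutFn (fanoutFn fstF sndF) id

/-- `wpF ∈ FP`. [cite: AroraBarakCC2009, §1.3] -/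
theorem wpF_mem_FP : wpF ∈ FP :=
  comp_mem_FP eqPairFn_mem_FP (fanoutFn_mem_FP (fanoutFn_mem_FP fstF_mem_FP sndF_mem_FP) id_mem_FP)

/-- Value of `wpF`. [folklore] -/
theorem wpF_apply (u : List Bool) : wpF u = [decide (boolPair (fstF u) (sndF u) = u)] := by
  simp [wpF, eqPairFn_boolPair]

/-- `wpF` is one-bit. [folklore] -/
theorem oneBit_wpF : OneBit wpF := fun u => ⟨_, wpF_apply u⟩

/-- **Canonical-numeral test** `canT u = [canonF u = u]` (`u = encodeNat m` for some `m`).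
[cite: AroraBarak2009, §0.1] -/
def canT : List Bool → List Bool := eqPairFn ∘ fanoutFn canonF id

/-- `canT ∈ FP`. [cite: AroraBarakCC2009, §1.3] -/
theorem canT_mem_FP : canT ∈ FP := comp_mem_FP eqPairFn_mem_FP (fanoutFn_mem_FP canonF_mem_FP id_mem_FP)

/-- Value of `canT`. [folklore] -/
theorem canT_apply (u : List Bool) : canT u = [decide (canonF u = u)] := by
  simp [canT, eqPairFn_boolPair]

/-- `canT` is one-bit. [folklore] -/
theorem oneBit_canT : OneBit canT := fun u => ⟨_, canT_apply u⟩

/-- The dimension numeral `nc` of an instance code `x = ⟨⟨nc, bits⟩, kc⟩`. [folklore] -/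
def ncF : List Bool → List Bool := fstF ∘ fstF
/-- The adjacency bit field `bits` of an instance code `x = ⟨⟨nc, bits⟩, kc⟩`. [folklore] -/
def bitsF : List Bool → List Bool := sndF ∘ fstF
/-- The clique-size numeral `kc` of an instance code `x = ⟨⟨nc, bits⟩, kc⟩`. [folklore] -/
def kcF : List Bool → List Bool := sndF

/-- `ncF ∈ FP`. [folklore] -/
theorem ncF_mem_FP : ncF ∈ FP := comp_mem_FP fstF_mem_FP fstF_mem_FP
/-- `bitsF ∈ FP`. [folklore] -/
theorem bitsF_mem_FP : bitsF ∈ FP := comp_mem_FP sndF_mem_FP fstF_mem_FP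
/-- `kcF ∈ FP`. [folklore] -/
theorem kcF_mem_FP : kcF ∈ FP := sndF_mem_FP

/-- The projections on the code of an instance. [folklore] -/
theorem proj_encode (n : ℕ) (G : SimpleGraph (Fin n)) (k : ℕ) :
    ncF (instEnc.encode (⟨n, G⟩, k)) = encodeNat n ∧ bitsF (instEnc.encode (⟨n, G⟩, k)) = adjBits n G ∧
      kcF (instEnc.encode (⟨n, G⟩, k)) = encodeNat k := by
  rw [instEnc_encode_eq]; simp [ncF, bitsF, kcF]

/-- The bit field fits in the code: `|bitsF x| ≤ |x|` on every string. [folklore] -/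
theorem length_bitsF_le (x : List Bool) : (bitsF x).length ≤ x.length := by
  have h1 := length_fstF_sndF_le x
  have h2 := length_fstF_sndF_le (fstF x)
  simp only [bitsF, Function.comp_apply]
  omega

/-- The dimension read off a string: `N = ⟦nc⟧`. [folklore] -/
def dimOf (x : List Bool) : ℕ := bitsToNat (ncF x)

/-- **Header test** `hdrT x = [|bits| = N²]`. [folklore] -/
def hdrT : List Bool → List Bool :=
  eqPairFn ∘ fanoutFn (lenBinF ∘ bitsF) (prodFn ∘ fanoutFn ncF ncF)

/-- `hdrT ∈ FP`. [cite: AroraBarakCC2009, §1.3] -/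
theorem hdrT_mem_FP : hdrT ∈ FP :=
  comp_mem_FP eqPairFn_mem_FP (fanoutFn_mem_FP (comp_mem_FP lenBinF_mem_FP bitsF_mem_FP)
    (comp_mem_FP prodFn_mem_FP (fanoutFn_mem_FP ncF_mem_FP ncF_mem_FP)))

/-- Value of `hdrT`. [folklore] -/
theorem hdrT_apply (x : List Bool) : hdrT x = [decide ((bitsF x).length = dimOf x * dimOf x)] := by
  simp only [hdrT, dimOf, Function.comp_apply, fanoutFn_apply, eqPairFn_boolPair, lenBinF_apply, prodFn_boolPair]
  congr 1
  apply Bool.decide_congr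
  exact ⟨fun h => by simpa using congrArg decodeNat h, fun h => by rw [h]⟩

/-- `hdrT` is one-bit. [folklore] -/
theorem oneBit_hdrT : OneBit hdrT := fun x => ⟨_, hdrT_apply x⟩

/-! ### The symmetry test: the bit matrix is symmetric with zero diagonal -/

/-- The first bit of `(l.drop t).take 1` is `l[t]` (default `false`). [folklore] -/
theorem headD_take_one_drop (l : List Bool) (t : ℕ) : ((l.drop t).take 1).headD false = l.getD t false := by
  rw [List.getD_eq_getElem?_getD, ← List.head?_drop, List.headD_eq_head?_getD]
  cases l.drop t <;> simp

/-- Unary strings are equal iff their lengths are. [folklore] -/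
theorem ones_inj {a b : ℕ} : ones a = ones b ↔ a = b :=
  ⟨fun h => by simpa using congrArg List.length h, fun h => by rw [h]⟩

/-- On `⟨x, u⟩`: the unary dimension `1^{min N |x|}` (`binToUnaryFn` against the ruler `x`). [folklore] -/
def sN : List Bool → List Bool := binToUnaryFn ∘ fanoutFn fstF (ncF ∘ fstF)
/-- On `⟨x, 1ᵗ⟩`: `⟨1^{t / N}, 1^{t % N}⟩`, the row and column of the flat index `t`. [folklore] -/
def sIJ : List Bool → List Bool := divModFn ∘ fanoutFn sN sndF
/-- On `⟨x, 1ᵗ⟩`: the bit `[bits t]`. [folklore] -/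
def sB : List Bool → List Bool := headBitFn ∘ bitAtFn ∘ fanoutFn sndF (bitsF ∘ fstF)
/-- On `⟨x, 1ᵗ⟩`: the transposed flat index `1^{(t % N) N + t / N}`. [folklore] -/
def sTT : List Bool → List Bool := appF ∘ fanoutFn (umulFn ∘ fanoutFn (sndF ∘ sIJ) sN) (fstF ∘ sIJ)
/-- On `⟨x, 1ᵗ⟩`: the transposed bit `[bits ((t % N) N + t / N)]`. [folklore] -/
def sBT : List Bool → List Bool := headBitFn ∘ bitAtFn ∘ fanoutFn sTT (bitsF ∘ fstF)
/-- On `⟨x, 1ᵗ⟩`: the diagonal test `[t / N = t % N]`. [folklore] -/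
def sEq : List Bool → List Bool := eqPairFn ∘ sIJ

/-- **The symmetry piece** on `⟨x, 1ᵗ⟩`: `bits t → (t / N ≠ t % N ∧ bits ((t % N) N + t / N))` — an
adjacency bit forces a distinct pair and the transposed bit. [cite: AroraBarak2009, §0.1 (undirected graphs as symmetric adjacency matrices)] -/
def symPiece : List Bool → List Bool := iteFn sB (andFn (notFn sEq) sBT) fun _ => [true]

/-- `sN ∈ FP`. [folklore] -/
theorem sN_mem_FP : sN ∈ FP :=
  comp_mem_FP binToUnaryFn_mem_FP (fanoutFn_mem_FP fstF_mem_FP (comp_mem_FP ncF_mem_FP fstF_mem_FP))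
/-- `sIJ ∈ FP`. [folklore] -/
theorem sIJ_mem_FP : sIJ ∈ FP := comp_mem_FP divModFn_mem_FP (fanoutFn_mem_FP sN_mem_FP sndF_mem_FP)
/-- `sB ∈ FP`. [folklore] -/
theorem sB_mem_FP : sB ∈ FP :=
  comp_mem_FP headBitFn_mem_FP (comp_mem_FP bitAtFn_mem_FP (fanoutFn_mem_FP sndF_mem_FP (comp_mem_FP bitsF_mem_FP fstF_mem_FP)))
/-- `sTT ∈ FP`. [folklore] -/
theorem sTT_mem_FP : sTT ∈ FP :=
  comp_mem_FP appF_mem_FP (fanoutFn_mem_FP (comp_mem_FP umulFn_mem_FP (fanoutFn_mem_FP (comp_mem_FP sndF_mem_FP sIJ_mem_FP) sN_mem_FP))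
    (comp_mem_FP fstF_mem_FP sIJ_mem_FP))
/-- `sBT ∈ FP`. [folklore] -/
theorem sBT_mem_FP : sBT ∈ FP :=
  comp_mem_FP headBitFn_mem_FP (comp_mem_FP bitAtFn_mem_FP (fanoutFn_mem_FP sTT_mem_FP (comp_mem_FP bitsF_mem_FP fstF_mem_FP)))
/-- `sEq ∈ FP`. [folklore] -/
theorem sEq_mem_FP : sEq ∈ FP := comp_mem_FP eqPairFn_mem_FP sIJ_mem_FP
/-- `symPiece ∈ FP`. [cite: AroraBarakCC2009, §1.3] -/
theorem symPiece_mem_FP : symPiece ∈ FP :=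
  iteFn_mem_FP sB_mem_FP (andFn_mem_FP (notFn_mem_FP sEq_mem_FP) sBT_mem_FP) (const_mem_FP _)

/-- `sB` is one-bit. [folklore] -/
theorem oneBit_sB : OneBit sB := oneBit_headBitFn.comp _
/-- `sBT` is one-bit. [folklore] -/
theorem oneBit_sBT : OneBit sBT := oneBit_headBitFn.comp _
/-- `sEq` is one-bit. [folklore] -/
theorem oneBit_sEq : OneBit sEq := oneBit_eqPairFn.comp _
/-- `symPiece` is one-bit. [folklore] -/
theorem oneBit_symPiece : OneBit symPiece :=
  oneBit_sB.ite (oneBit_andFn (oneBit_notFn oneBit_sEq) oneBit_sBT) (oneBit_const true)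

/-- The Boolean decided by the symmetry piece at the flat index `t` of the bit field of `x`:
`bits t → (t / N ≠ t % N ∧ bits ((t % N) N + t / N))`. [folklore] -/
def symAtB (x : List Bool) (t : ℕ) : Bool :=
  !(bitsF x).getD t false ||
    (!decide (t / dimOf x = t % dimOf x) && (bitsF x).getD (t % dimOf x * dimOf x + t / dimOf x) false)

/-- Truth of `symAtB`. [folklore] -/
theorem symAtB_eq_true_iff (x : List Bool) (t : ℕ) :
    symAtB x t = true ↔ ((bitsF x).getD t false = true →
      t / dimOf x ≠ t % dimOf x ∧ (bitsF x).getD (t % dimOf x * dimOf x + t / dimOf x) false = true) := by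
  unfold symAtB
  cases (bitsF x).getD t false <;> simp

/-- **Value of the symmetry piece** on `⟨x, 1ᵗ⟩` when the dimension fits in the ruler (`N ≤ |x|`).
[folklore] -/
theorem symPiece_apply {x : List Bool} (hN : dimOf x ≤ x.length) (t : ℕ) :
    symPiece (boolPair x (ones t)) = [symAtB x t] := by
  have hN' : bitsToNat (ncF x) ≤ x.length := hN
  have hsN : sN (boolPair x (ones t)) = ones (dimOf x) := by
    rw [sN, Function.comp_apply, fanoutFn_apply, fstF_boolPair, Function.comp_apply, fstF_boolPair,
      binToUnaryFn_boolPair, min_eq_left hN']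
    rfl
  have hij : sIJ (boolPair x (ones t)) = boolPair (ones (t / dimOf x)) (ones (t % dimOf x)) := by
    rw [sIJ, Function.comp_apply, fanoutFn_apply, hsN, sndF_boolPair, divModFn_boolPair]
  have hB : sB (boolPair x (ones t)) = [(bitsF x).getD t false] := by
    rw [sB, Function.comp_apply, Function.comp_apply, fanoutFn_apply, sndF_boolPair, Function.comp_apply,
      fstF_boolPair, bitAtFn_boolPair, headBitFn_apply, List.length_replicate, headD_take_one_drop]
  have hTT : sTT (boolPair x (ones t)) = ones (t % dimOf x * dimOf x + t / dimOf x) := by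
    rw [sTT, Function.comp_apply, fanoutFn_apply, Function.comp_apply, fanoutFn_apply, Function.comp_apply, hij,
      sndF_boolPair, hsN, umulFn_boolPair, Function.comp_apply, hij, fstF_boolPair, appF_boolPair, List.replicate_append_replicate]
  have hBT : sBT (boolPair x (ones t)) = [(bitsF x).getD (t % dimOf x * dimOf x + t / dimOf x) false] := by
    rw [sBT, Function.comp_apply, Function.comp_apply, fanoutFn_apply, hTT, Function.comp_apply, fstF_boolPair,
      bitAtFn_boolPair, headBitFn_apply, List.length_replicate, headD_take_one_drop]
  have hEq : sEq (boolPair x (ones t)) = [decide (t / dimOf x = t % dimOf x)] := by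
    rw [sEq, Function.comp_apply, hij, eqPairFn_boolPair]
    simp only [ones_inj]
  rw [symPiece, iteFn_apply hB]
  unfold symAtB
  cases hb : (bitsF x).getD t false
  · simp
  · rw [if_pos rfl, andFn_apply (notFn_apply hEq) hBT]
    simp

/-- **The symmetry test** `symT x = [∀ t < |bits|, SymAt x t]`: the index-all fold of the piece over the
bit field (yardstick `bitsF`). [cite: AroraBarakCC2009, §1.3 (bounded loops)] -/
def symT : List Bool → List Bool := allIdxFn bitsF symPiece

/-- `symT ∈ FP`. [cite: AroraBarakCC2009, §1.3 (bounded loops)] -/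
theorem symT_mem_FP : symT ∈ FP := allIdxFn_mem_FP bitsF_mem_FP symPiece_mem_FP oneBit_symPiece

/-- `symT` is one-bit. [folklore] -/
theorem oneBit_symT : OneBit symT := oneBit_allIdxFn oneBit_symPiece length_bitsF_le

/-- The proposition decided by `symT`: symmetric bit matrix with zero diagonal. [folklore] -/
def SymOK (x : List Bool) : Prop := ∀ t < (bitsF x).length, symAtB x t = true

/-- `SymOK` is decidable. [folklore] -/
instance SymOK.decidable (x : List Bool) : Decidable (SymOK x) := by
  unfold SymOK; infer_instance

/-- **Value of the symmetry test** when the dimension fits in the ruler. [folklore] -/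
theorem symT_apply {x : List Bool} (hN : dimOf x ≤ x.length) : symT x = [decide (SymOK x)] := by
  rw [symT, allIdxFn_apply oneBit_symPiece (length_bitsF_le x)]
  refine congrArg (fun b => [b]) (Bool.decide_congr ?_)
  simp only [symPiece_apply hN, List.cons.injEq, and_true]
  rfl

/-! ### The graph-code test -/

/-- **The graph-code test**: well paired twice, canonical numerals, `n²` adjacency bits forming a
symmetric matrix with zero diagonal. [cite: AroraBarak2009, §0.1] -/
def codeT : List Bool → List Bool :=
  andFn wpF (andFn (wpF ∘ fstF) (andFn (canT ∘ ncF) (andFn (canT ∘ kcF) (andFn hdrT symT))))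

/-- **`codeT ∈ FP`.** [cite: AroraBarakCC2009, §1.3] -/
theorem codeT_mem_FP : codeT ∈ FP :=
  andFn_mem_FP wpF_mem_FP (andFn_mem_FP (comp_mem_FP wpF_mem_FP fstF_mem_FP)
    (andFn_mem_FP (comp_mem_FP canT_mem_FP ncF_mem_FP) (andFn_mem_FP (comp_mem_FP canT_mem_FP kcF_mem_FP)
      (andFn_mem_FP hdrT_mem_FP symT_mem_FP))))

/-- The proposition decided by `codeT`. [folklore] -/
def CodeOK (x : List Bool) : Prop :=
  boolPair (fstF x) (sndF x) = x ∧ boolPair (ncF x) (bitsF x) = fstF x ∧ canonF (ncF x) = ncF x ∧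
    canonF (kcF x) = kcF x ∧ (bitsF x).length = dimOf x * dimOf x ∧ SymOK x

/-- `CodeOK` is decidable. [folklore] -/
instance CodeOK.decidable : DecidablePred CodeOK := fun x => by
  unfold CodeOK; infer_instance

/-- If the header test passes, the dimension fits in the ruler: `N ≤ N² = |bits| ≤ |x|`. [folklore] -/
theorem dimOf_le_length {x : List Bool} (h : (bitsF x).length = dimOf x * dimOf x) : dimOf x ≤ x.length := by
  have h1 := length_bitsF_le x
  rcases Nat.eq_zero_or_pos (dimOf x) with h0 | hpos
  · omega
  · nlinarith

/-- **Value of the graph-code test.** [folklore] -/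
theorem codeT_apply (x : List Bool) : codeT x = [decide (CodeOK x)] := by
  obtain ⟨b, hb⟩ := oneBit_symT x
  have hb' : symT x = [decide (b = true)] := by rw [hb, Bool.decide_eq_true]
  have h : codeT x = [decide (boolPair (fstF x) (sndF x) = x ∧ (boolPair (fstF (fstF x)) (sndF (fstF x)) = fstF x ∧
      (canonF (ncF x) = ncF x ∧ (canonF (kcF x) = kcF x ∧ ((bitsF x).length = dimOf x * dimOf x ∧ b = true)))))] :=
    andFn_decide (wpF_apply x) (andFn_decide (by rw [Function.comp_apply, wpF_apply])
      (andFn_decide (by rw [Function.comp_apply, canT_apply]) (andFn_decide (by rw [Function.comp_apply, canT_apply])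
        (andFn_decide (hdrT_apply x) hb'))))
  rw [h]
  congr 1
  apply Bool.decide_congr
  unfold CodeOK
  change _ ∧ boolPair (ncF x) (bitsF x) = fstF x ∧ _ ↔ _
  constructor
  · rintro ⟨h1, h2, h3, h4, h5, h6⟩
    have hs := symT_apply (dimOf_le_length h5)
    rw [hb, h6] at hs
    exact ⟨h1, h2, h3, h4, h5, of_decide_eq_true (List.cons.inj hs).1.symm⟩
  · rintro ⟨h1, h2, h3, h4, h5, h6⟩
    have hs := symT_apply (dimOf_le_length h5)
    rw [hb, decide_eq_true h6] at hs
    exact ⟨h1, h2, h3, h4, h5, (List.cons.inj hs).1⟩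

/-- `codeT` is one-bit. [folklore] -/
theorem oneBit_codeT : OneBit codeT := fun x => ⟨_, codeT_apply x⟩

/-! ### The graph-code test recognises exactly the codes of instances -/

/-- A canonical numeral re-encodes to itself. [folklore] -/
theorem canonF_encodeNat (m : ℕ) : canonF (encodeNat m) = encodeNat m := by
  rw [canonF_eq_encodeNat_decodeNat, decode_encodeNat]

open Classical in
/-- **The test accepts the code of every instance.** [folklore] -/
theorem codeOK_encode (n : ℕ) (G : SimpleGraph (Fin n)) (k : ℕ) : CodeOK (instEnc.encode (⟨n, G⟩, k)) := by
  obtain ⟨hnc, hbits, hkc⟩ := proj_encode n G k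
  have hdim : dimOf (instEnc.encode (⟨n, G⟩, k)) = n := by rw [dimOf, hnc, bitsToNat_encodeNat]
  refine ⟨?_, ?_, ?_, ?_, ?_, ?_⟩
  · rw [instEnc_encode_eq]; simp
  · rw [hnc, hbits, instEnc_encode_eq]; simp
  · rw [hnc, canonF_encodeNat]
  · rw [hkc, canonF_encodeNat]
  · rw [hbits, hdim, length_adjBits]
  · intro t ht
    rw [hbits, length_adjBits] at ht
    rw [symAtB_eq_true_iff, hbits, hdim, getD_adjBits G ht]
    intro hadj
    have hadj' := of_decide_eq_true hadj
    refine ⟨fun h => G.ne_of_adj hadj' (Fin.ext h), ?_⟩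
    have e := getD_adjBits_flat G ⟨t % n, Nat.mod_lt _ (pos_of_lt_mul ht)⟩ ⟨t / n, div_lt_of_lt_mul ht⟩
    dsimp only at e
    rw [e]
    exact decide_eq_true hadj'.symm

/-- **A string passing the test is the code of an instance.** The graph is `SimpleGraph.fromRel` of the
bit relation, which the symmetry test makes symmetric and irreflexive, so that its adjacency bits are
the given ones. [folklore] -/
theorem exists_eq_encode_of_codeOK {x : List Bool} (h : CodeOK x) :
    ∃ (n : ℕ) (G : SimpleGraph (Fin n)) (k : ℕ), x = instEnc.encode (⟨n, G⟩, k) := by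
  obtain ⟨hwp, hwp', hnc, hkc, hhdr, hsym⟩ := h
  -- the dimension
  set n := decodeNat (ncF x) with hn
  have hnc' : ncF x = encodeNat n := by rw [← hnc, canonF_eq_encodeNat_decodeNat]
  have hdim : dimOf x = n := by rw [dimOf, hnc', bitsToNat_encodeNat]
  -- the bits
  set bits := bitsF x with hbitsdef
  have hlen : bits.length = n * n := by rw [hhdr, hdim]
  -- the graph
  set R : Fin n → Fin n → Prop := fun i j => bits.getD (i * n + j) false = true with hRdef
  have hR : ∀ i j, R i j → i ≠ j ∧ R j i := by
    intro i j hij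
    have hs := (symAtB_eq_true_iff x _).1 (hsym _ (by rw [hlen]; exact flat_lt i j)) hij
    rw [hdim, flat_div, flat_mod] at hs
    exact ⟨fun h => hs.1 (by rw [h]), hs.2⟩
  set G := SimpleGraph.fromRel R with hGdef
  have hG : ∀ i j, G.Adj i j ↔ R i j := fun i j => by
    rw [hGdef, SimpleGraph.fromRel_adj]
    exact ⟨fun ⟨_, h⟩ => h.elim id fun h => (hR _ _ h).2, fun h => ⟨(hR _ _ h).1, Or.inl h⟩⟩
  have hadj : adjBits n G = bits := by
    refine List.ext_getElem (by rw [length_adjBits, hlen]) fun t h1 h2 => ?_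
    have ht : t < n * n := by simpa using h1
    have e1 := getD_adjBits G ht
    rw [List.getD_eq_getElem _ _ h1] at e1
    rw [e1, ← List.getD_eq_getElem _ false h2]
    have key : G.Adj ⟨t / n, div_lt_of_lt_mul ht⟩ ⟨t % n, Nat.mod_lt _ (pos_of_lt_mul ht)⟩ ↔
        bits.getD t false = true := by
      rw [hG]
      change bits.getD (t / n * n + t % n) false = true ↔ _
      rw [Nat.div_add_mod' t n]
    simp [key]
  -- the clique size
  set k := decodeNat (kcF x) with hk
  have hkc' : kcF x = encodeNat k := by rw [← hkc, canonF_eq_encodeNat_decodeNat]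
  refine ⟨n, G, k, ?_⟩
  calc x = boolPair (fstF x) (sndF x) := hwp.symm
    _ = boolPair (boolPair (ncF x) bits) (kcF x) := by rw [hwp']; rfl
    _ = instEnc.encode (⟨n, G⟩, k) := by rw [instEnc_encode_eq, ← hnc', ← hkc', hadj]

/-- **`codeT x = [1]` iff `x` is the code of an instance.** [cite: AroraBarak2009, §0.1] -/
theorem codeT_eq_true_iff (x : List Bool) :
    codeT x = [true] ↔ ∃ (n : ℕ) (G : SimpleGraph (Fin n)) (k : ℕ), x = instEnc.encode (⟨n, G⟩, k) := by
  rw [codeT_apply]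
  simp only [List.cons.injEq, and_true, decide_eq_true_eq]
  exact ⟨exists_eq_encode_of_codeOK, fun ⟨n, G, k, hx⟩ => hx ▸ codeOK_encode n G k⟩

/-- A language cut out by a one-bit `FP` test is in `P`. [cite: AroraBarakCC2009, Def. 1.13] -/
theorem mem_P_of_oneBit {g : List Bool → List Bool} (hg : g ∈ FP) (h1 : OneBit g) :
    ({w | g w = [true]} : Language Bool) ∈ Classes.P :=
  mem_P_of_mem_FP hg _ fun w =>
    ⟨fun h => h, fun h => by
      obtain ⟨b, hb⟩ := h1 w
      cases b
      · exact hb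
      · exact absurd hb h⟩

/-- **The language of graph-instance codes.** [cite: Karp1972, §4 Main Theorem, problem 3] -/
def codeLang : Language Bool := {x | codeT x = [true]}

/-- **`codeLang ∈ P`.** [cite: AroraBarakCC2009, Def. 1.13 and §1.3] -/
theorem codeLang_mem_P : codeLang ∈ Classes.P := mem_P_of_oneBit codeT_mem_FP oneBit_codeT

/-- Membership in `codeLang`: exactly the codes of instances. [folklore] -/
theorem mem_codeLang_iff (x : List Bool) :
    x ∈ codeLang ↔ ∃ (n : ℕ) (G : SimpleGraph (Fin n)) (k : ℕ), x = instEnc.encode (⟨n, G⟩, k) :=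
  codeT_eq_true_iff x

/-! ### The clique verifier: projections of `w = ⟨x, y⟩`, `x = ⟨⟨nc, bits⟩, kc⟩` -/

/-- The first bit of `l.drop i` is `l[i]` (default `false`). [folklore] -/
theorem headD_drop (l : List Bool) (i : ℕ) : (l.drop i).headD false = l.getD i false := by
  rw [List.getD_eq_getElem?_getD, ← List.head?_drop, List.headD_eq_head?_getD]

/-- **Length test** `lenT w = [encodeNat |y| = nc]`: the witness is a bit vector of the dimension.
[cite: Karp1972, §4 Main Theorem, problem 3] -/
def lenT : List Bool → List Bool := eqPairFn ∘ fanoutFn (lenBinF ∘ sndF) (ncF ∘ fstF)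

/-- **Count test** `cntT w = [¬ (#1(y) < ⟦kc⟧)]`: at least `k` chosen vertices. [cite: Karp1972, §4 Main Theorem, problem 3] -/
def cntT : List Bool → List Bool := notFn (ltFn ∘ fanoutFn (popCountFn ∘ sndF) (kcF ∘ fstF))

/-- `lenT ∈ FP`. [cite: AroraBarakCC2009, §1.3] -/
theorem lenT_mem_FP : lenT ∈ FP :=
  comp_mem_FP eqPairFn_mem_FP (fanoutFn_mem_FP (comp_mem_FP lenBinF_mem_FP sndF_mem_FP) (comp_mem_FP ncF_mem_FP fstF_mem_FP))

/-- `cntT ∈ FP`. [cite: AroraBarakCC2009, §1.3] -/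
theorem cntT_mem_FP : cntT ∈ FP :=
  notFn_mem_FP (comp_mem_FP ltFn_mem_FP (fanoutFn_mem_FP (comp_mem_FP popCountFn_mem_FP sndF_mem_FP)
    (comp_mem_FP kcF_mem_FP fstF_mem_FP)))

/-- `lenT` is one-bit. [folklore] -/
theorem oneBit_lenT : OneBit lenT := oneBit_eqPairFn.comp _

/-- `cntT` is one-bit. [folklore] -/
theorem oneBit_cntT : OneBit cntT := oneBit_notFn (oneBit_ltFn.comp _)

/-! ### The piece function of the pair test: the flat index `t = i n + j` on `⟨w, 1ᵗ⟩` -/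

/-- On `⟨w, u⟩`: the unary dimension `1^{min n |w|}`. [folklore] -/
def pN : List Bool → List Bool := binToUnaryFn ∘ fanoutFn fstF (ncF ∘ fstF ∘ fstF)
/-- On `⟨w, 1ᵗ⟩`: `⟨1^{t / n}, 1^{t % n}⟩`. [folklore] -/
def pIJ : List Bool → List Bool := divModFn ∘ fanoutFn pN sndF
/-- On `⟨w, 1ᵗ⟩`: the witness bit `[y (t / n)]` (default `false`). [folklore] -/
def pYI : List Bool → List Bool := headBitFn ∘ dropFn ∘ fanoutFn (fstF ∘ pIJ) (sndF ∘ fstF)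
/-- On `⟨w, 1ᵗ⟩`: the witness bit `[y (t % n)]` (default `false`). [folklore] -/
def pYJ : List Bool → List Bool := headBitFn ∘ dropFn ∘ fanoutFn (sndF ∘ pIJ) (sndF ∘ fstF)
/-- On `⟨w, 1ᵗ⟩`: the adjacency bit `[bits t]`. [folklore] -/
def pB : List Bool → List Bool := headBitFn ∘ bitAtFn ∘ fanoutFn sndF (bitsF ∘ fstF ∘ fstF)
/-- On `⟨w, 1ᵗ⟩`: the diagonal test `[t / n = t % n]`. [folklore] -/
def pEq : List Bool → List Bool := eqPairFn ∘ pIJ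

/-- **The pair piece** on `⟨w, 1ᵗ⟩`: two distinct chosen vertices `i = t / n`, `j = t % n` must be
adjacent, `y i ∧ y j ∧ i ≠ j → bits t` ("a set of `k` mutually adjacent nodes").
[cite: Karp1972, §4 Main Theorem, problem 3] -/
def pairPiece : List Bool → List Bool := iteFn (andFn pYI (andFn pYJ (notFn pEq))) pB fun _ => [true]

/-- `pN ∈ FP`. [folklore] -/
theorem pN_mem_FP : pN ∈ FP :=
  comp_mem_FP binToUnaryFn_mem_FP (fanoutFn_mem_FP fstF_mem_FP (comp_mem_FP ncF_mem_FP (comp_mem_FP fstF_mem_FP fstF_mem_FP)))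
/-- `pIJ ∈ FP`. [folklore] -/
theorem pIJ_mem_FP : pIJ ∈ FP := comp_mem_FP divModFn_mem_FP (fanoutFn_mem_FP pN_mem_FP sndF_mem_FP)
/-- `pYI ∈ FP`. [folklore] -/
theorem pYI_mem_FP : pYI ∈ FP :=
  comp_mem_FP headBitFn_mem_FP (comp_mem_FP dropFn_mem_FP (fanoutFn_mem_FP (comp_mem_FP fstF_mem_FP pIJ_mem_FP)
    (comp_mem_FP sndF_mem_FP fstF_mem_FP)))
/-- `pYJ ∈ FP`. [folklore] -/
theorem pYJ_mem_FP : pYJ ∈ FP :=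
  comp_mem_FP headBitFn_mem_FP (comp_mem_FP dropFn_mem_FP (fanoutFn_mem_FP (comp_mem_FP sndF_mem_FP pIJ_mem_FP)
    (comp_mem_FP sndF_mem_FP fstF_mem_FP)))
/-- `pB ∈ FP`. [folklore] -/
theorem pB_mem_FP : pB ∈ FP :=
  comp_mem_FP headBitFn_mem_FP (comp_mem_FP bitAtFn_mem_FP (fanoutFn_mem_FP sndF_mem_FP
    (comp_mem_FP bitsF_mem_FP (comp_mem_FP fstF_mem_FP fstF_mem_FP))))
/-- `pEq ∈ FP`. [folklore] -/
theorem pEq_mem_FP : pEq ∈ FP := comp_mem_FP eqPairFn_mem_FP pIJ_mem_FP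
/-- **`pairPiece ∈ FP`.** [cite: AroraBarakCC2009, §1.3] -/
theorem pairPiece_mem_FP : pairPiece ∈ FP :=
  iteFn_mem_FP (andFn_mem_FP pYI_mem_FP (andFn_mem_FP pYJ_mem_FP (notFn_mem_FP pEq_mem_FP))) pB_mem_FP (const_mem_FP _)

/-- `pYI` is one-bit. [folklore] -/
theorem oneBit_pYI : OneBit pYI := oneBit_headBitFn.comp _
/-- `pYJ` is one-bit. [folklore] -/
theorem oneBit_pYJ : OneBit pYJ := oneBit_headBitFn.comp _
/-- `pB` is one-bit. [folklore] -/
theorem oneBit_pB : OneBit pB := oneBit_headBitFn.comp _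
/-- `pEq` is one-bit. [folklore] -/
theorem oneBit_pEq : OneBit pEq := oneBit_eqPairFn.comp _
/-- `pairPiece` is one-bit. [folklore] -/
theorem oneBit_pairPiece : OneBit pairPiece :=
  (oneBit_andFn oneBit_pYI (oneBit_andFn oneBit_pYJ (oneBit_notFn oneBit_pEq))).ite oneBit_pB (oneBit_const true)

/-- The Boolean decided by the pair piece at the flat index `t`: `y (t / n) ∧ y (t % n) ∧ t / n ≠ t % n →
bits t`. [folklore] -/
def pairAtB (n : ℕ) (bits y : List Bool) (t : ℕ) : Bool :=
  !(y.getD (t / n) false && (y.getD (t % n) false && !decide (t / n = t % n))) || bits.getD t false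

/-- **The pair test** `prT w = [∀ t < |bits|, pairPiece ⟨w, 1ᵗ⟩ = [1]]` (index-all fold, yardstick the
bit field). [cite: AroraBarakCC2009, §1.3 (bounded loops)] -/
def prT : List Bool → List Bool := allIdxFn (bitsF ∘ fstF) pairPiece

/-- The yardstick of the pair test fits: `|bitsF (fstF w)| ≤ |w|`. [folklore] -/
theorem length_bitsF_fstF_le (w : List Bool) : ((bitsF ∘ fstF) w).length ≤ w.length :=
  (length_bitsF_le (fstF w)).trans (by have := length_fstF_sndF_le w; omega)

/-- `prT ∈ FP`. [cite: AroraBarakCC2009, §1.3 (bounded loops)] -/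
theorem prT_mem_FP : prT ∈ FP :=
  allIdxFn_mem_FP (comp_mem_FP bitsF_mem_FP fstF_mem_FP) pairPiece_mem_FP oneBit_pairPiece

/-- `prT` is one-bit. [folklore] -/
theorem oneBit_prT : OneBit prT := oneBit_allIdxFn oneBit_pairPiece length_bitsF_fstF_le

/-- **The clique verifier**: accept `⟨x, y⟩` iff `y` is a bit vector of the dimension choosing at least
`k` vertices that are pairwise adjacent. [cite: Karp1972, §4 Main Theorem, problem 3] -/
def verifT : List Bool → List Bool := andFn lenT (andFn cntT prT)

/-- **The verifier is polynomial-time**: `verifT ∈ FP`. [cite: AroraBarakCC2009, §1.3] -/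
theorem verifT_mem_FP : verifT ∈ FP := andFn_mem_FP lenT_mem_FP (andFn_mem_FP cntT_mem_FP prT_mem_FP)

/-- The verifier answers one bit on every input. [folklore] -/
theorem oneBit_verifT : OneBit verifT := oneBit_andFn oneBit_lenT (oneBit_andFn oneBit_cntT oneBit_prT)

/-- The `P` language of accepted pairs `⟨x, y⟩`. [cite: AroraBarakCC2009, Def. 2.1] -/
def verifLang : Language Bool := {w | verifT w = [true]}

/-- **`verifLang ∈ P`.** [cite: AroraBarakCC2009, Def. 1.13 and §1.3] -/
theorem verifLang_mem_P : verifLang ∈ Classes.P := mem_P_of_oneBit verifT_mem_FP oneBit_verifT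

/-! ### The value of the verifier on the code of an instance -/

section Decode

variable (n : ℕ) (G : SimpleGraph (Fin n)) (k : ℕ) (y : List Bool)

/-- `n ≤ |w|` for `w = ⟨code (⟨n, G⟩, k), y⟩`. [folklore] -/
theorem n_le_length_pair : n ≤ (boolPair (instEnc.encode (⟨n, G⟩, k)) y).length := by
  have h := n_le_length_encode n G k
  rw [length_boolPair]
  omega

variable {n} in
/-- **The value of the pair piece** on `⟨w, 1ᵗ⟩`. [folklore] -/
theorem pairPiece_encode (t : ℕ) :
    pairPiece (boolPair (boolPair (instEnc.encode (⟨n, G⟩, k)) y) (ones t)) = [pairAtB n (adjBits n G) y t] := by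
  set w := boolPair (instEnc.encode (⟨n, G⟩, k)) y with hw
  obtain ⟨hnc, hbits, -⟩ := proj_encode n G k
  have hN : pN (boolPair w (ones t)) = ones n := by
    simp only [pN, Function.comp_apply, fanoutFn_apply, fstF_boolPair, hw, hnc]
    rw [binToUnaryFn_boolPair, bitsToNat_encodeNat, min_eq_left (n_le_length_pair n G k y)]
  have hij : pIJ (boolPair w (ones t)) = boolPair (ones (t / n)) (ones (t % n)) := by
    rw [pIJ, Function.comp_apply, fanoutFn_apply, hN, sndF_boolPair, divModFn_boolPair]
  have hy : sndF (fstF (boolPair w (ones t))) = y := by rw [fstF_boolPair, hw, sndF_boolPair]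
  have hyi : pYI (boolPair w (ones t)) = [y.getD (t / n) false] := by
    rw [pYI, Function.comp_apply, Function.comp_apply, fanoutFn_apply, Function.comp_apply, hij, fstF_boolPair,
      Function.comp_apply, hy, dropFn_boolPair, headBitFn_apply, List.length_replicate, headD_drop]
  have hyj : pYJ (boolPair w (ones t)) = [y.getD (t % n) false] := by
    rw [pYJ, Function.comp_apply, Function.comp_apply, fanoutFn_apply, Function.comp_apply, hij, sndF_boolPair,
      Function.comp_apply, hy, dropFn_boolPair, headBitFn_apply, List.length_replicate, headD_drop]
  have hb : pB (boolPair w (ones t)) = [(adjBits n G).getD t false] := by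
    simp only [pB, Function.comp_apply, fanoutFn_apply, sndF_boolPair, fstF_boolPair, hw, hbits]
    rw [bitAtFn_boolPair, headBitFn_apply, List.length_replicate, headD_take_one_drop]
  have heq : pEq (boolPair w (ones t)) = [decide (t / n = t % n)] := by
    rw [pEq, Function.comp_apply, hij, eqPairFn_boolPair]
    simp only [ones_inj]
  rw [pairPiece, iteFn_apply (andFn_apply hyi (andFn_apply hyj (notFn_apply heq)))]
  unfold pairAtB
  cases y.getD (t / n) false <;> cases y.getD (t % n) false <;> by_cases h : t / n = t % n <;> simp [h, hb]

/-- **The exact value of the verifier on the code of ANY instance paired with ANY string.**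
[cite: Karp1972, §4 Main Theorem, problem 3] -/
theorem verifT_encode :
    verifT (boolPair (instEnc.encode (⟨n, G⟩, k)) y) =
      [decide (y.length = n ∧ (k ≤ y.count true ∧ ∀ t < n * n, pairAtB n (adjBits n G) y t = true))] := by
  set w := boolPair (instEnc.encode (⟨n, G⟩, k)) y with hw
  obtain ⟨hnc, hbits, hkc⟩ := proj_encode n G k
  have hlen : lenT w = [decide (y.length = n)] := by
    rw [lenT, Function.comp_apply, fanoutFn_apply, Function.comp_apply, hw, sndF_boolPair, lenBinF_apply,
      Function.comp_apply, fstF_boolPair, hnc, eqPairFn_boolPair]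
    simp only [encodeNat_inj]
  have hcnt : cntT w = [decide (k ≤ y.count true)] := by
    have h1 : (ltFn ∘ fanoutFn (popCountFn ∘ sndF) (kcF ∘ fstF)) w = [decide (y.count true < k)] := by
      rw [Function.comp_apply, fanoutFn_apply, Function.comp_apply, hw, sndF_boolPair, popCountFn_apply,
        Function.comp_apply, fstF_boolPair, hkc, ltFn_boolPair, bitsToNat_encodeNat, bitsToNat_encodeNat]
    rw [cntT, notFn_apply h1]
    simp only [List.cons.injEq, and_true]
    rw [← decide_not]
    exact Bool.decide_congr Nat.not_lt
  have hpr : prT w = [decide (∀ t < n * n, pairAtB n (adjBits n G) y t = true)] := by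
    rw [prT, allIdxFn_apply oneBit_pairPiece (length_bitsF_fstF_le w)]
    have hl : ((bitsF ∘ fstF) w).length = n * n := by
      rw [Function.comp_apply, hw, fstF_boolPair, hbits, length_adjBits]
    refine congrArg (fun b => [b]) (Bool.decide_congr ?_)
    rw [hl]
    simp only [hw, pairPiece_encode, List.cons.injEq, and_true]
  rw [verifT]
  exact andFn_decide hlen (andFn_decide hcnt hpr)

end Decode

/-! ### From bits to cliques -/

/-- The number of `1`s of a bit list as a sum. [folklore] -/
theorem count_true_eq_sum_map_toNat (l : List Bool) : l.count true = (l.map Bool.toNat).sum := by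
  induction l with
  | nil => rfl
  | cons b l ih => cases b <;> simp [ih, Nat.add_comm]

/-- **The number of `1`s of a characteristic vector is the size of the set.** [folklore] -/
theorem count_true_ofFn {n : ℕ} (f : Fin n → Bool) :
    (List.ofFn f).count true = (univ.filter fun i => f i = true).card := by
  rw [count_true_eq_sum_map_toNat, List.map_ofFn, List.sum_ofFn, Finset.card_filter]
  refine Finset.sum_congr rfl fun i _ => ?_
  rw [Function.comp_apply]
  cases f i <;> rfl

/-- Reading a characteristic vector. [folklore] -/
theorem getD_ofFn {n : ℕ} (f : Fin n → Bool) (i : Fin n) : (List.ofFn f).getD i false = f i := by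
  rw [List.getD_eq_getElem _ _ (by simp), List.getElem_ofFn]

/-- A bit list of length `n` is the characteristic vector of the bits it holds. [folklore] -/
theorem ofFn_getD {n : ℕ} {y : List Bool} (hy : y.length = n) :
    (List.ofFn fun i : Fin n => y.getD i false) = y := by
  subst hy
  refine List.ext_getElem (by simp) fun i h1 h2 => ?_
  rw [List.getElem_ofFn, List.getD_eq_getElem _ _ h2]

open Classical in
/-- **The pair test holds at every flat index iff the chosen vertices are pairwise adjacent.**
[cite: Karp1972, §4 Main Theorem, problem 3 ("a set of k mutually adjacent nodes")] -/
theorem forall_pairAtB_iff {n : ℕ} (G : SimpleGraph (Fin n)) (y : List Bool) :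
    (∀ t < n * n, pairAtB n (adjBits n G) y t = true) ↔
      ∀ i j : Fin n, y.getD i false = true → y.getD j false = true → i ≠ j → G.Adj i j := by
  constructor
  · intro h i j hi hj hij
    have ht := h _ (flat_lt i j)
    unfold pairAtB at ht
    rw [flat_div, flat_mod, getD_adjBits_flat, hi, hj] at ht
    have hne : ¬ ((i : ℕ) = j) := fun e => hij (Fin.ext e)
    simpa [hne] using ht
  · intro h t ht
    unfold pairAtB
    rw [getD_adjBits G ht]
    by_cases hd : t / n = t % n
    · simp [hd]
    · cases hi : y.getD (t / n) false
      · simp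
      · cases hj : y.getD (t % n) false
        · simp
        · have hadj := h ⟨t / n, div_lt_of_lt_mul ht⟩ ⟨t % n, Nat.mod_lt _ (pos_of_lt_mul ht)⟩ hi hj
            (fun e => hd (congrArg Fin.val e))
          simp [hd, hadj]

/-! ### `CLIQUE ∈ NP` -/

/-- **The certificate form of the clique question over `codeLang`** (witness length `≤ |x|`).
[cite: Karp1972, §3 Def. 4 (NP by p-bounded existential quantification)] [cite: AroraBarakCC2009, Def. 2.1] -/
def witnessLang : Language Bool :=
  {x | ∃ y : List Bool, y.length ≤ (X : Polynomial ℕ).eval x.length ∧ boolPair x y ∈ verifLang}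

/-- `witnessLang ∈ NP`. [cite: AroraBarakCC2009, Def. 2.1] -/
theorem witnessLang_mem_NP : witnessLang ∈ Nondeterministic.NP :=
  ⟨verifLang, verifLang_mem_P, X, fun _ => Iff.rfl⟩

open Classical in
/-- **`CLIQUE` is the intersection of the code language with the certificate language**: a `k`-clique
`s` gives the witness `List.ofFn (· ∈ s)` (length `n ≤ |x|`); an accepted witness chooses a set of at
least `k` pairwise adjacent vertices, which contains a `k`-clique.
[cite: Karp1972, §4 Main Theorem, problem 3] [cite: AroraBarakCC2009, Def. 2.1] -/
theorem CLIQUE_eq_inter : CLIQUE = codeLang ⊓ witnessLang := by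
  ext x
  constructor
  · rintro ⟨⟨⟨n, G⟩, k⟩, hmem, rfl⟩
    have hcl : ¬ G.CliqueFree k := hmem
    obtain ⟨s, hs⟩ : ∃ s, G.IsNClique k s := by simpa [SimpleGraph.CliqueFree] using hcl
    refine ⟨(mem_codeLang_iff _).2 ⟨n, G, k, rfl⟩, List.ofFn (fun i : Fin n => decide (i ∈ s)), ?_, ?_⟩
    · rw [eval_X, List.length_ofFn]
      exact n_le_length_encode n G k
    · change verifT _ = [true]
      rw [verifT_encode, List.length_ofFn, count_true_ofFn]
      refine congrArg (fun b => [b]) (decide_eq_true ⟨rfl, ?_, (forall_pairAtB_iff G _).2 ?_⟩)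
      · have hS : (univ.filter fun i : Fin n => decide (i ∈ s) = true) = s := by
          ext i; simp
        rw [hS, hs.card_eq]
      · intro i j hi hj hij
        rw [getD_ofFn] at hi hj
        exact hs.isClique (Finset.mem_coe.2 (of_decide_eq_true hi)) (Finset.mem_coe.2 (of_decide_eq_true hj)) hij
  · rintro ⟨hcode, y, -, hacc⟩
    obtain ⟨n, G, k, rfl⟩ := (mem_codeLang_iff x).1 hcode
    change verifT _ = [true] at hacc
    rw [verifT_encode] at hacc
    obtain ⟨hlen, hk, hpairs⟩ := of_decide_eq_true (List.cons.inj hacc).1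
    rw [forall_pairAtB_iff] at hpairs
    set S : Finset (Fin n) := univ.filter fun i => y.getD i false = true with hS
    have hclique : G.IsClique (S : Set (Fin n)) := by
      intro i hi j hj hij
      rw [Finset.mem_coe, hS, Finset.mem_filter] at hi hj
      exact hpairs i j hi.2 hj.2 hij
    have hcard : k ≤ S.card := by
      rw [hS, ← count_true_ofFn (fun i : Fin n => y.getD i false), ofFn_getD hlen]
      exact hk
    obtain ⟨s, hsS, hs⟩ := Finset.exists_subset_card_eq hcard
    exact ⟨(⟨n, G⟩, k), fun hfree => hfree s ⟨hclique.subset (Finset.coe_subset.2 hsS), hs⟩, rfl⟩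

/-- **`CLIQUE ∈ NP`** (membership half of `isNPComplete_CLIQUE`; Karp 1972: "It is clear that these
problems … are all in NP"): a `P` language intersected with a language in certificate form over a `P`
verifier (`inter_P_mem_polyExists`). [cite: Karp1972, §4 Main Theorem, problem 3] [cite: AroraBarakCC2009, Def. 2.1] -/
theorem CLIQUE_mem_NP : CLIQUE ∈ Nondeterministic.NP := by
  rw [CLIQUE_eq_inter]
  exact inter_P_mem_polyExists (K := Classes.P) (fun _ _ a b => inter_mem_P a b) codeLang_mem_P witnessLang_mem_NP

end CliqueNP

/-- **`CLIQUE ∈ NP`** (Karp 1972, §4: the problems of the Main Theorem "are all in NP"; here problem 3,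
CLIQUE, for the tree's `CLIQUE = (encodingGraph.pairBool encodingNatBool).toLanguage cliqueSet`).
[cite: Karp1972, §4 Main Theorem, problem 3] -/
theorem CLIQUE_mem_NP : CLIQUE ∈ Nondeterministic.NP := CliqueNP.CLIQUE_mem_NP

end Literature.Computability.Complexity

end
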